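import Mathlib
import Summits.Ventures.PercRepro2.Defs
import Summits.Ventures.PercRepro2.Harris
import Summits.Ventures.PercRepro2.Graph
import Summits.Ventures.PercRepro2.Events
import Summits.Ventures.PercRepro2.PsiPinInduction
import Summits.Ventures.PercRepro2.PsiUniSure
import Summits.Ventures.PercRepro2.PsiUniExplored

/-!
# The pin induction for (Ψ₀′) along the `o`-exploration (PercRepro2, p2)

The second open inequality of the (PM⁺) line, **(Ψ₀′)** — the hypothesis `hP` of
`psi_bern_t_of_r21_psi0` — reads `0 ≤ S(p)` with the slack

  `S(p) = Ug·(L·(q − A) + q·M) − q·G`,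
  `Ug = P(C_s ∈ 𝓤)`, `L = P(𝟙ℓ)`, `q = P(𝟙)`, `A = P(𝟙a)`, `M = P(𝟙ℓa)`, `G = P(𝟙ℓ g)`

(`𝟙 = {s ↮ y}`, `a = {u ∈ C_s}`, `ℓ = {o ↔ y}`, `g = {C_s ∈ 𝓤}`).  Along one edge `f` every mass is
affine in `w = p f` (`prob_eq_pin`), so `S` is a CUBIC in `w` with Bernstein form
`S = (1 − w)³·S⁰ + (1 − w)²w·C₁ + (1 − w)w²·C₂ + w³·S¹` (`psi0_slack_eq_bernstein`), `S⁰, S¹` the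
slacks of the two pinned instances and `C₁, C₂` three times the mixed coefficients.  Hence the slack is
nonnegative as soon as the pinned slacks are and `C₁, C₂ ≥ 0` (`psi0_step_algebra`).

The induction runs along the `o`-EXPLORATION: when every edge at the explored `o`-component is
pinned, the cluster of `o` is deterministic with a closed boundary and the slack is IDENTICALLY ZERO
(`psi0_slack_eq_zero_of_explored_o`: `s ∈ Λ` or `y ∉ Λ` make `ℓ` null or `𝟙` null, `s ∉ Λ ∋ y` makes
`ℓ` and `𝟙` sure and the slack collapses to `Ug − Ug`), so the frame `psi0_slack_nonneg_of_bern_o`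
says: **(Ψ₀′) holds for every admissible weight vector as soon as every admissible vector with an
unpinned edge at its explored `o`-component has SOME such edge `f` with `C₁, C₂ ≥ 0`** — the
statement (BERN-Ψ₀′_o) of P2-G19-YCLUSTER.md §3e (census: `C₁, C₂ ≥ 0` on 33,359 / 33,359 edges).
This is the cubic twin of `psi_slack_nonneg_of_bern_t` for the (Ψ)-slack and of
`r21_slack_nonneg_of_uni_o` for (R2-1).

* `psi0_bernstein_algebra` — the cubic identity in thirteen variables;
* `psi0_step_algebra` — the one-edge step;
* `psi0_slack_eq_bernstein` — the Bernstein form of the slack along an edge;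
* `psi0Pin_slack_eq_zero` — the slack of a point mass vanishes;
* `psi0_slack_nonneg_of_step` — the pin induction (one good edge per instance);
* `psi0_slack_eq_zero_of_explored_o` — the base: the slack vanishes when the `o`-cluster is explored;
* `psi0_slack_nonneg_of_bern_o` — **the frame (Ψ₀′) ⟸ (BERN-Ψ₀′_o)**.
-/

namespace Summit.Ventures.PercRepro2

section Psi0Pin

variable {V : Type*} {E : Type*} [Fintype E] [DecidableEq E]
  {R : Type*} [CommRing R] [LinearOrder R] [IsStrictOrderedRing R]

omit [LinearOrder R] [IsStrictOrderedRing R] in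
/-- The cubic identity behind the one-edge Bernstein form of the (Ψ₀′) slack: with every mass
`X = (1 − w)·x0 + w·x1`, `U(L(Q − A) + QM) − QG` equals
`(1 − w)³·S⁰ + (1 − w)²w·C₁ + (1 − w)w²·C₂ + w³·S¹`. -/
lemma psi0_bernstein_algebra (w u0 l0 q0 a0 m0 g0 u1 l1 q1 a1 m1 g1 : R) :
    ((1 - w) * u0 + w * u1) * (((1 - w) * l0 + w * l1) * (((1 - w) * q0 + w * q1) - ((1 - w) * a0 + w * a1)) +
        ((1 - w) * q0 + w * q1) * ((1 - w) * m0 + w * m1)) -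
      ((1 - w) * q0 + w * q1) * ((1 - w) * g0 + w * g1) =
      (1 - w) ^ 3 * (u0 * (l0 * (q0 - a0) + q0 * m0) - q0 * g0) +
        (1 - w) ^ 2 * w * (-a0 * l0 * u1 - a0 * l1 * u0 - a1 * l0 * u0 - g0 * q0 - g0 * q1 - g1 * q0 + l0 * q0 * u1 + l0 * q1 * u0 + l1 * q0 * u0 + m0 * q0 * u1 + m0 * q1 * u0 + m1 * q0 * u0) +
        (1 - w) * w ^ 2 * (-a0 * l1 * u1 - a1 * l0 * u1 - a1 * l1 * u0 - g0 * q1 - g1 * q0 - g1 * q1 + l0 * q1 * u1 + l1 * q0 * u1 + l1 * q1 * u0 + m0 * q1 * u1 + m1 * q0 * u1 + m1 * q1 * u0) +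
        w ^ 3 * (u1 * (l1 * (q1 - a1) + q1 * m1) - q1 * g1) := by
  ring

/-- **The one-edge step.** If `0 ≤ w ≤ 1` and all four Bernstein coefficients are nonnegative, the
cubic is nonnegative. -/
lemma psi0_step_algebra {w S0 S1 C1 C2 : R} (hw : 0 ≤ w) (hw1 : w ≤ 1) (h0 : 0 ≤ S0) (h1 : 0 ≤ S1)
    (hC1 : 0 ≤ C1) (hC2 : 0 ≤ C2) :
    0 ≤ (1 - w) ^ 3 * S0 + (1 - w) ^ 2 * w * C1 + (1 - w) * w ^ 2 * C2 + w ^ 3 * S1 := by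
  have hw' : 0 ≤ 1 - w := by linarith
  positivity

omit [LinearOrder R] [IsStrictOrderedRing R] in
/-- **The Bernstein form of the (Ψ₀′) slack along an edge `f`**: with `w = p f`,
`S(p) = (1 − w)³·S(p[f↦0]) + (1 − w)²w·C₁ + (1 − w)w²·C₂ + w³·S(p[f↦1])`. -/
lemma psi0_slack_eq_bernstein (p : E → R) (ends : E → Sym2 V) (s y o u : V) (𝓤 : Set (Set V)) (f : E) :
    (prob p (clusterInEvent ends s 𝓤) * (prob p (connEvent ends y o ∩ (connEvent ends s y)ᶜ) * (prob p ((connEvent ends s y)ᶜ) - prob p (connEvent ends s u ∩ (connEvent ends s y)ᶜ)) + prob p ((connEvent ends s y)ᶜ) * prob p (connEvent ends s u ∩ connEvent ends y o ∩ (connEvent ends s y)ᶜ)) - prob p ((connEvent ends s y)ᶜ) * prob p (clusterInEvent ends s 𝓤 ∩ connEvent ends y o ∩ (connEvent ends s y)ᶜ)) =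
      (1 - p f) ^ 3 * (prob (Function.update p f 0) (clusterInEvent ends s 𝓤) * (prob (Function.update p f 0) (connEvent ends y o ∩ (connEvent ends s y)ᶜ) * (prob (Function.update p f 0) ((connEvent ends s y)ᶜ) - prob (Function.update p f 0) (connEvent ends s u ∩ (connEvent ends s y)ᶜ)) + prob (Function.update p f 0) ((connEvent ends s y)ᶜ) * prob (Function.update p f 0) (connEvent ends s u ∩ connEvent ends y o ∩ (connEvent ends s y)ᶜ)) - prob (Function.update p f 0) ((connEvent ends s y)ᶜ) * prob (Function.update p f 0) (clusterInEvent ends s 𝓤 ∩ connEvent ends y o ∩ (connEvent ends s y)ᶜ)) +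
        (1 - p f) ^ 2 * p f * (-prob (Function.update p f 0) (connEvent ends s u ∩ (connEvent ends s y)ᶜ) * prob (Function.update p f 0) (connEvent ends y o ∩ (connEvent ends s y)ᶜ) * prob (Function.update p f 1) (clusterInEvent ends s 𝓤) - prob (Function.update p f 0) (connEvent ends s u ∩ (connEvent ends s y)ᶜ) * prob (Function.update p f 1) (connEvent ends y o ∩ (connEvent ends s y)ᶜ) * prob (Function.update p f 0) (clusterInEvent ends s 𝓤) - prob (Function.update p f 1) (connEvent ends s u ∩ (connEvent ends s y)ᶜ) * prob (Function.update p f 0) (connEvent ends y o ∩ (connEvent ends s y)ᶜ) * prob (Function.update p f 0) (clusterInEvent ends s 𝓤) - prob (Function.update p f 0) (clusterInEvent ends s 𝓤 ∩ connEvent ends y o ∩ (connEvent ends s y)ᶜ) * prob (Function.update p f 0) ((connEvent ends s y)ᶜ) - prob (Function.update p f 0) (clusterInEvent ends s 𝓤 ∩ connEvent ends y o ∩ (connEvent ends s y)ᶜ) * prob (Function.update p f 1) ((connEvent ends s y)ᶜ) - prob (Function.update p f 1) (clusterInEvent ends s 𝓤 ∩ connEvent ends y o ∩ (connEvent ends s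 y)ᶜ) * prob (Function.update p f 0) ((connEvent ends s y)ᶜ) + prob (Function.update p f 0) (connEvent ends y o ∩ (connEvent ends s y)ᶜ) * prob (Function.update p f 0) ((connEvent ends s y)ᶜ) * prob (Function.update p f 1) (clusterInEvent ends s 𝓤) + prob (Function.update p f 0) (connEvent ends y o ∩ (connEvent ends s y)ᶜ) * prob (Function.update p f 1) ((connEvent ends s y)ᶜ) * prob (Function.update p f 0) (clusterInEvent ends s 𝓤) + prob (Function.update p f 1) (connEvent ends y o ∩ (connEvent ends s y)ᶜ) * prob (Function.update p f 0) ((connEvent ends s y)ᶜ) * prob (Function.update p f 0) (clusterInEvent ends s 𝓤) + prob (Function.update p f 0) (connEvent ends s u ∩ connEvent ends y o ∩ (connEvent ends s y)ᶜ) * prob (Function.update p f 0) ((connEvent ends s y)ᶜ) * prob (Function.update p f 1) (clusterInEvent ends s 𝓤) + prob (Function.update p f 0) (connEvent ends s u ∩ connEvent ends y o ∩ (connEvent ends s y)ᶜ) * prob (Function.update p f 1) ((connEvent ends s y)ᶜ) * prob (Function.update p f 0) (clusterInEvent ends s 𝓤) + prob (Function.update p f 1) (connEvent ends s u ∩ connEvent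 ends y o ∩ (connEvent ends s y)ᶜ) * prob (Function.update p f 0) ((connEvent ends s y)ᶜ) * prob (Function.update p f 0) (clusterInEvent ends s 𝓤)) +
        (1 - p f) * p f ^ 2 * (-prob (Function.update p f 0) (connEvent ends s u ∩ (connEvent ends s y)ᶜ) * prob (Function.update p f 1) (connEvent ends y o ∩ (connEvent ends s y)ᶜ) * prob (Function.update p f 1) (clusterInEvent ends s 𝓤) - prob (Function.update p f 1) (connEvent ends s u ∩ (connEvent ends s y)ᶜ) * prob (Function.update p f 0) (connEvent ends y o ∩ (connEvent ends s y)ᶜ) * prob (Function.update p f 1) (clusterInEvent ends s 𝓤) - prob (Function.update p f 1) (connEvent ends s u ∩ (connEvent ends s y)ᶜ) * prob (Function.update p f 1) (connEvent ends y o ∩ (connEvent ends s y)ᶜ) * prob (Function.update p f 0) (clusterInEvent ends s 𝓤) - prob (Function.update p f 0) (clusterInEvent ends s 𝓤 ∩ connEvent ends y o ∩ (connEvent ends s y)ᶜ) * prob (Function.update p f 1) ((connEvent ends s y)ᶜ) - prob (Function.update p f 1) (clusterInEvent ends s 𝓤 ∩ connEvent ends y o ∩ (connEvent ends s y)ᶜ)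 * prob (Function.update p f 0) ((connEvent ends s y)ᶜ) - prob (Function.update p f 1) (clusterInEvent ends s 𝓤 ∩ connEvent ends y o ∩ (connEvent ends s y)ᶜ) * prob (Function.update p f 1) ((connEvent ends s y)ᶜ) + prob (Function.update p f 0) (connEvent ends y o ∩ (connEvent ends s y)ᶜ) * prob (Function.update p f 1) ((connEvent ends s y)ᶜ) * prob (Function.update p f 1) (clusterInEvent ends s 𝓤) + prob (Function.update p f 1) (connEvent ends y o ∩ (connEvent ends s y)ᶜ) * prob (Function.update p f 0) ((connEvent ends s y)ᶜ) * prob (Function.update p f 1) (clusterInEvent ends s 𝓤) + prob (Function.update p f 1) (connEvent ends y o ∩ (connEvent ends s y)ᶜ) * prob (Function.update p f 1) ((connEvent ends s y)ᶜ) * prob (Function.update p f 0) (clusterInEvent ends s 𝓤) + prob (Function.update p f 0) (connEvent ends s u ∩ connEvent ends y o ∩ (connEvent ends s y)ᶜ) * prob (Function.update p f 1) ((connEvent ends s y)ᶜ) * prob (Function.update p f 1) (clusterInEvent ends s 𝓤) + prob (Function.update p f 1) (connEvent ends s u ∩ connEvent ends y o ∩ (connEvent ends s y)ᶜ) * prob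 (Function.update p f 0) ((connEvent ends s y)ᶜ) * prob (Function.update p f 1) (clusterInEvent ends s 𝓤) + prob (Function.update p f 1) (connEvent ends s u ∩ connEvent ends y o ∩ (connEvent ends s y)ᶜ) * prob (Function.update p f 1) ((connEvent ends s y)ᶜ) * prob (Function.update p f 0) (clusterInEvent ends s 𝓤)) +
        p f ^ 3 * (prob (Function.update p f 1) (clusterInEvent ends s 𝓤) * (prob (Function.update p f 1) (connEvent ends y o ∩ (connEvent ends s y)ᶜ) * (prob (Function.update p f 1) ((connEvent ends s y)ᶜ) - prob (Function.update p f 1) (connEvent ends s u ∩ (connEvent ends s y)ᶜ)) + prob (Function.update p f 1) ((connEvent ends s y)ᶜ) * prob (Function.update p f 1) (connEvent ends s u ∩ connEvent ends y o ∩ (connEvent ends s y)ᶜ)) - prob (Function.update p f 1) ((connEvent ends s y)ᶜ) * prob (Function.update p f 1) (clusterInEvent ends s 𝓤 ∩ connEvent ends y o ∩ (connEvent ends s y)ᶜ)) := by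
  have e := psi0_bernstein_algebra (p f)
    (prob (Function.update p f 0) (clusterInEvent ends s 𝓤))
    (prob (Function.update p f 0) (connEvent ends y o ∩ (connEvent ends s y)ᶜ))
    (prob (Function.update p f 0) ((connEvent ends s y)ᶜ))
    (prob (Function.update p f 0) (connEvent ends s u ∩ (connEvent ends s y)ᶜ))
    (prob (Function.update p f 0) (connEvent ends s u ∩ connEvent ends y o ∩ (connEvent ends s y)ᶜ))
    (prob (Function.update p f 0) (clusterInEvent ends s 𝓤 ∩ connEvent ends y o ∩ (connEvent ends s y)ᶜ))
    (prob (Function.update p f 1) (clusterInEvent ends s 𝓤))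
    (prob (Function.update p f 1) (connEvent ends y o ∩ (connEvent ends s y)ᶜ))
    (prob (Function.update p f 1) ((connEvent ends s y)ᶜ))
    (prob (Function.update p f 1) (connEvent ends s u ∩ (connEvent ends s y)ᶜ))
    (prob (Function.update p f 1) (connEvent ends s u ∩ connEvent ends y o ∩ (connEvent ends s y)ᶜ))
    (prob (Function.update p f 1) (clusterInEvent ends s 𝓤 ∩ connEvent ends y o ∩ (connEvent ends s y)ᶜ))
  rw [← e]
  rw [prob_eq_pin p (clusterInEvent ends s 𝓤) f]
  rw [prob_eq_pin p (connEvent ends y o ∩ (connEvent ends s y)ᶜ) f]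
  rw [prob_eq_pin p ((connEvent ends s y)ᶜ) f]
  rw [prob_eq_pin p (connEvent ends s u ∩ (connEvent ends s y)ᶜ) f]
  rw [prob_eq_pin p (connEvent ends s u ∩ connEvent ends y o ∩ (connEvent ends s y)ᶜ) f]
  rw [prob_eq_pin p (clusterInEvent ends s 𝓤 ∩ connEvent ends y o ∩ (connEvent ends s y)ᶜ) f]
  ring

/-- For a point mass the (Ψ₀′) slack vanishes identically (the boolean identity
`g(ℓ𝟙(𝟙 − a𝟙) + 𝟙·aℓ𝟙) − 𝟙·gℓ𝟙 = 0`). -/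
lemma psi0Pin_slack_eq_zero (p : E → R) (h01 : ∀ e, p e = 0 ∨ p e = 1)
    (ends : E → Sym2 V) (s y o u : V) (𝓤 : Set (Set V)) :
    (prob p (clusterInEvent ends s 𝓤) * (prob p (connEvent ends y o ∩ (connEvent ends s y)ᶜ) * (prob p ((connEvent ends s y)ᶜ) - prob p (connEvent ends s u ∩ (connEvent ends s y)ᶜ)) + prob p ((connEvent ends s y)ᶜ) * prob p (connEvent ends s u ∩ connEvent ends y o ∩ (connEvent ends s y)ᶜ)) - prob p ((connEvent ends s y)ᶜ) * prob p (clusterInEvent ends s 𝓤 ∩ connEvent ends y o ∩ (connEvent ends s y)ᶜ)) = 0 := by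
  classical
  simp only [psiPin_prob_eq_indicator h01]
  simp only [Set.indicator_apply, Set.mem_inter_iff, Set.mem_compl_iff, Pi.one_apply]
  by_cases h1 : (fun e => decide (p e = 1) : Config E) ∈ clusterInEvent ends s 𝓤 <;>
  by_cases h2 : (fun e => decide (p e = 1) : Config E) ∈ connEvent ends y o <;>
  by_cases h3 : (fun e => decide (p e = 1) : Config E) ∈ connEvent ends s u <;>
  by_cases h4 : (fun e => decide (p e = 1) : Config E) ∈ connEvent ends s y <;>
  simp [h1, h2, h3, h4]

/-- **The pin induction for (Ψ₀′).** If every admissible `p` with an unpinned edge has SOME unpinned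
edge `f` such that the slack at `p` is nonnegative whenever the slacks at the two pins are, then the
slack is nonnegative for every admissible `p`. -/
theorem psi0_slack_nonneg_of_step (ends : E → Sym2 V) (s y o u : V) (𝓤 : Set (Set V))
    (hstep : ∀ p : E → R, IsProbVec p → (∃ e, p e ≠ 0 ∧ p e ≠ 1) →
      ∃ f, p f ≠ 0 ∧ p f ≠ 1 ∧
        (0 ≤ (prob (Function.update p f 0) (clusterInEvent ends s 𝓤) * (prob (Function.update p f 0) (connEvent ends y o ∩ (connEvent ends s y)ᶜ) * (prob (Function.update p f 0) ((connEvent ends s y)ᶜ) - prob (Function.update p f 0) (connEvent ends s u ∩ (connEvent ends s y)ᶜ)) + prob (Function.update p f 0) ((connEvent ends s y)ᶜ) * prob (Function.update p f 0) (connEvent ends s u ∩ connEvent ends y o ∩ (connEvent ends s y)ᶜ)) - prob (Function.update p f 0) ((connEvent ends s y)ᶜ) * prob (Function.update p f 0) (clusterInEvent ends s 𝓤 ∩ connEvent ends y o ∩ (connEvent ends s y)ᶜ)) →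
        0 ≤ (prob (Function.update p f 1) (clusterInEvent ends s 𝓤) * (prob (Function.update p f 1) (connEvent ends y o ∩ (connEvent ends s y)ᶜ) * (prob (Function.update p f 1) ((connEvent ends s y)ᶜ) - prob (Function.update p f 1) (connEvent ends s u ∩ (connEvent ends s y)ᶜ)) + prob (Function.update p f 1) ((connEvent ends s y)ᶜ) * prob (Function.update p f 1) (connEvent ends s u ∩ connEvent ends y o ∩ (connEvent ends s y)ᶜ)) - prob (Function.update p f 1) ((connEvent ends s y)ᶜ) * prob (Function.update p f 1) (clusterInEvent ends s 𝓤 ∩ connEvent ends y o ∩ (connEvent ends s y)ᶜ)) →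
        0 ≤ (prob p (clusterInEvent ends s 𝓤) * (prob p (connEvent ends y o ∩ (connEvent ends s y)ᶜ) * (prob p ((connEvent ends s y)ᶜ) - prob p (connEvent ends s u ∩ (connEvent ends s y)ᶜ)) + prob p ((connEvent ends s y)ᶜ) * prob p (connEvent ends s u ∩ connEvent ends y o ∩ (connEvent ends s y)ᶜ)) - prob p ((connEvent ends s y)ᶜ) * prob p (clusterInEvent ends s 𝓤 ∩ connEvent ends y o ∩ (connEvent ends s y)ᶜ)))) :
    ∀ p : E → R, IsProbVec p → 0 ≤ (prob p (clusterInEvent ends s 𝓤) * (prob p (connEvent ends y o ∩ (connEvent ends s y)ᶜ) * (prob p ((connEvent ends s y)ᶜ) - prob p (connEvent ends s u ∩ (connEvent ends s y)ᶜ)) + prob p ((connEvent ends s y)ᶜ) * prob p (connEvent ends s u ∩ connEvent ends y o ∩ (connEvent ends s y)ᶜ)) - prob p ((connEvent ends s y)ᶜ) * prob p (clusterInEvent ends s 𝓤 ∩ connEvent ends y o ∩ (connEvent ends s y)ᶜ)) := by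
  have key : ∀ n : ℕ, ∀ p : E → R, IsProbVec p →
      (Finset.univ.filter fun e => p e ≠ 0 ∧ p e ≠ 1).card = n → 0 ≤ (prob p (clusterInEvent ends s 𝓤) * (prob p (connEvent ends y o ∩ (connEvent ends s y)ᶜ) * (prob p ((connEvent ends s y)ᶜ) - prob p (connEvent ends s u ∩ (connEvent ends s y)ᶜ)) + prob p ((connEvent ends s y)ᶜ) * prob p (connEvent ends s u ∩ connEvent ends y o ∩ (connEvent ends s y)ᶜ)) - prob p ((connEvent ends s y)ᶜ) * prob p (clusterInEvent ends s 𝓤 ∩ connEvent ends y o ∩ (connEvent ends s y)ᶜ)) := by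
    intro n
    induction n with
    | zero =>
      intro p hp hcard
      have h01 : ∀ e, p e = 0 ∨ p e = 1 := by
        intro e
        by_contra hne
        have hne' : p e ≠ 0 ∧ p e ≠ 1 := ⟨fun h => hne (Or.inl h), fun h => hne (Or.inr h)⟩
        have : e ∈ (Finset.univ.filter fun e => p e ≠ 0 ∧ p e ≠ 1) := by
          simp [hne']
        rw [Finset.card_eq_zero.1 hcard] at this
        exact absurd this (Finset.notMem_empty e)
      rw [psi0Pin_slack_eq_zero p h01 ends s y o u 𝓤]
    | succ n ih =>
      intro p hp hcard
      have hex : ∃ e, p e ≠ 0 ∧ p e ≠ 1 := by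
        have hpos : 0 < (Finset.univ.filter fun e => p e ≠ 0 ∧ p e ≠ 1).card := by
          rw [hcard]; exact Nat.succ_pos n
        obtain ⟨e, he⟩ := Finset.card_pos.1 hpos
        simp only [Finset.mem_filter, Finset.mem_univ, true_and] at he
        exact ⟨e, he⟩
      obtain ⟨f, hf0, hf1, hstepf⟩ := hstep p hp hex
      have hmem : f ∈ (Finset.univ.filter fun e => p e ≠ 0 ∧ p e ≠ 1) := by simp [hf0, hf1]
      have hcard' : ∀ c : R, c = 0 ∨ c = 1 →
          (Finset.univ.filter fun e => Function.update p f c e ≠ 0 ∧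
            Function.update p f c e ≠ 1).card = n := by
        intro c hc
        rw [psiPin_filter_unpinned_update p f c hc, Finset.card_erase_of_mem hmem, hcard]
        rfl
      have h0 := ih (Function.update p f 0) (hp.update f le_rfl zero_le_one) (hcard' 0 (Or.inl rfl))
      have h1 := ih (Function.update p f 1) (hp.update f zero_le_one le_rfl) (hcard' 1 (Or.inr rfl))
      exact hstepf h0 h1
  intro p hp
  exact key _ p hp rfl

/-- **The base of the `o`-exploration for (Ψ₀′).** When every edge at the explored `o`-component is
pinned, the slack vanishes: `s ∈ Λ ∧ y ∈ Λ` (`𝟙` null), `y ∉ Λ` (`ℓ` null), `s ∉ Λ ∧ y ∈ Λ` (`ℓ` and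
`𝟙` sure: the slack collapses to `Ug − Ug`). -/
lemma psi0_slack_eq_zero_of_explored_o (p : E → R) (hp : IsProbVec p) (ends : E → Sym2 V)
    (s y o u : V) (𝓤 : Set (Set V))
    (hpin : ∀ e, (∃ v ∈ ends e, Conn ends (fun e => decide (p e = 1)) o v) → p e = 0 ∨ p e = 1) :
    (prob p (clusterInEvent ends s 𝓤) * (prob p (connEvent ends y o ∩ (connEvent ends s y)ᶜ) * (prob p ((connEvent ends s y)ᶜ) - prob p (connEvent ends s u ∩ (connEvent ends s y)ᶜ)) + prob p ((connEvent ends s y)ᶜ) * prob p (connEvent ends s u ∩ connEvent ends y o ∩ (connEvent ends s y)ᶜ)) - prob p ((connEvent ends s y)ᶜ) * prob p (clusterInEvent ends s 𝓤 ∩ connEvent ends y o ∩ (connEvent ends s y)ᶜ)) = 0 := by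
  classical
  have hl_eq : connEvent ends y o = connEvent ends o y := connEvent_comm _ _ _
  have null_left : ∀ A B : Set (Config E), prob p A = 0 → prob p (A ∩ B) = 0 := fun A B hA =>
    le_antisymm ((prob_mono hp Set.inter_subset_left).trans hA.le) (prob_nonneg hp _)
  by_cases hy : Conn ends (fun e => decide (p e = 1)) o y
  · have hl : prob p (connEvent ends y o) = 1 := by
      rw [hl_eq]; exact prob_connEvent_eq_one_of_explored p ends hy
    by_cases hs : Conn ends (fun e => decide (p e = 1)) o s
    · -- `s, y ∈ Λ`: `s ↔ y` is sure, `𝟙` is null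
      have hso : prob p (connEvent ends o s) = 1 := prob_connEvent_eq_one_of_explored p ends hs
      have hsy : prob p (connEvent ends s y) = 1 := by
        refine le_antisymm (prob_le_one hp _) ?_
        have h1 : prob p (connEvent ends o s ∩ connEvent ends o y) = 1 := by
          rw [prob_inter_of_eq_one hp (by rw [hl_eq] at hl; exact hl), hso]
        rw [← h1]
        refine prob_mono hp fun ω hω => ?_
        exact conn_trans (conn_symm hω.1) hω.2
      have hq : prob p (connEvent ends s y)ᶜ = 0 := by rw [prob_compl, hsy]; ring
      rw [prob_inter_eq_zero_of_right hp hq, hq, prob_inter_eq_zero_of_right hp hq,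
        prob_inter_eq_zero_of_right hp hq, prob_inter_eq_zero_of_right hp hq]
      ring
    · -- `s ∉ Λ ∋ y`: `ℓ` sure, `𝟙` sure
      have hso : prob p (connEvent ends o s) = 0 := prob_connEvent_eq_zero_of_explored p ends hpin hs
      have hsy : prob p (connEvent ends s y) = 0 := by
        refine le_antisymm ?_ (prob_nonneg hp _)
        rw [← prob_inter_of_eq_one hp hl (connEvent ends s y), ← hso]
        refine prob_mono hp fun ω hω => ?_
        exact conn_symm (conn_trans hω.1 hω.2)
      have hq : prob p (connEvent ends s y)ᶜ = 1 := by rw [prob_compl, hsy]; ring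
      rw [prob_inter_of_eq_one hp hq (connEvent ends y o), hl, hq,
        prob_inter_of_eq_one hp hq (connEvent ends s u),
        prob_inter_of_eq_one hp hq (connEvent ends s u ∩ connEvent ends y o),
        prob_inter_of_eq_one hp hl (connEvent ends s u),
        prob_inter_of_eq_one hp hq (clusterInEvent ends s 𝓤 ∩ connEvent ends y o),
        prob_inter_of_eq_one hp hl (clusterInEvent ends s 𝓤)]
      ring
  · -- `y ∉ Λ`: `ℓ` is null
    have hl : prob p (connEvent ends y o) = 0 := by
      rw [hl_eq]; exact prob_connEvent_eq_zero_of_explored p ends hpin hy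
    rw [null_left (connEvent ends y o) _ hl,
      null_left (connEvent ends s u ∩ connEvent ends y o) _ (prob_inter_eq_zero_of_right hp hl _),
      null_left (clusterInEvent ends s 𝓤 ∩ connEvent ends y o) _ (prob_inter_eq_zero_of_right hp hl _)]
    ring

/-- **The frame (Ψ₀′) ⟸ (BERN-Ψ₀′_o).** If every admissible `p` with an unpinned edge at its explored
`o`-component has SOME such edge `f` with nonnegative mixed Bernstein coefficients `C₁, C₂`, then
(Ψ₀′) holds for every admissible `p` — in the multiplied-out form of `psi_bern_t_of_r21_psi0`'s
hypothesis `hP`. -/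
theorem psi0_slack_nonneg_of_bern_o (ends : E → Sym2 V) (s y o u : V) (𝓤 : Set (Set V))
    (hbern : ∀ p : E → R, IsProbVec p →
      (∃ e, (∃ v ∈ ends e, Conn ends (fun e => decide (p e = 1)) o v) ∧ p e ≠ 0 ∧ p e ≠ 1) →
      ∃ f, (∃ v ∈ ends f, Conn ends (fun e => decide (p e = 1)) o v) ∧ p f ≠ 0 ∧ p f ≠ 1 ∧
        0 ≤ (-prob (Function.update p f 0) (connEvent ends s u ∩ (connEvent ends s y)ᶜ) * prob (Function.update p f 0) (connEvent ends y o ∩ (connEvent ends s y)ᶜ) * prob (Function.update p f 1) (clusterInEvent ends s 𝓤) - prob (Function.update p f 0) (connEvent ends s u ∩ (connEvent ends s y)ᶜ) * prob (Function.update p f 1) (connEvent ends y o ∩ (connEvent ends s y)ᶜ) * prob (Function.update p f 0) (clusterInEvent ends s 𝓤) - prob (Function.update p f 1) (connEvent ends s u ∩ (connEvent ends s y)ᶜ) * prob (Function.update p f 0) (connEvent ends y o ∩ (connEvent ends s y)ᶜ) * prob (Function.update p f 0) (clusterInEvent ends s 𝓤) - prob (Function.update p f 0) (clusterInEvent ends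 s 𝓤 ∩ connEvent ends y o ∩ (connEvent ends s y)ᶜ) * prob (Function.update p f 0) ((connEvent ends s y)ᶜ) - prob (Function.update p f 0) (clusterInEvent ends s 𝓤 ∩ connEvent ends y o ∩ (connEvent ends s y)ᶜ) * prob (Function.update p f 1) ((connEvent ends s y)ᶜ) - prob (Function.update p f 1) (clusterInEvent ends s 𝓤 ∩ connEvent ends y o ∩ (connEvent ends s y)ᶜ) * prob (Function.update p f 0) ((connEvent ends s y)ᶜ) + prob (Function.update p f 0) (connEvent ends y o ∩ (connEvent ends s y)ᶜ) * prob (Function.update p f 0) ((connEvent ends s y)ᶜ) * prob (Function.update p f 1) (clusterInEvent ends s 𝓤) + prob (Function.update p f 0) (connEvent ends y o ∩ (connEvent ends s y)ᶜ) * prob (Function.update p f 1) ((connEvent ends s y)ᶜ) * prob (Function.update p f 0) (clusterInEvent ends s 𝓤) + prob (Function.update p f 1) (connEvent ends y o ∩ (connEvent ends s y)ᶜ) * prob (Function.update p f 0) ((connEvent ends s y)ᶜ) * prob (Function.update p f 0) (clusterInEvent ends s 𝓤) + prob (Function.update p f 0) (connEvent ends s u ∩ connEvent ends y o ∩ (connEvent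 ends s y)ᶜ) * prob (Function.update p f 0) ((connEvent ends s y)ᶜ) * prob (Function.update p f 1) (clusterInEvent ends s 𝓤) + prob (Function.update p f 0) (connEvent ends s u ∩ connEvent ends y o ∩ (connEvent ends s y)ᶜ) * prob (Function.update p f 1) ((connEvent ends s y)ᶜ) * prob (Function.update p f 0) (clusterInEvent ends s 𝓤) + prob (Function.update p f 1) (connEvent ends s u ∩ connEvent ends y o ∩ (connEvent ends s y)ᶜ) * prob (Function.update p f 0) ((connEvent ends s y)ᶜ) * prob (Function.update p f 0) (clusterInEvent ends s 𝓤)) ∧ 0 ≤ (-prob (Function.update p f 0) (connEvent ends s u ∩ (connEvent ends s y)ᶜ) * prob (Function.update p f 1) (connEvent ends y o ∩ (connEvent ends s y)ᶜ) * prob (Function.update p f 1) (clusterInEvent ends s 𝓤) - prob (Function.update p f 1) (connEvent ends s u ∩ (connEvent ends s y)ᶜ) * prob (Function.update p f 0) (connEvent ends y o ∩ (connEvent ends s y)ᶜ) * prob (Function.update p f 1) (clusterInEvent ends s 𝓤) - prob (Function.update p f 1) (connEvent ends s u ∩ (connEvent ends s y)ᶜ) * prob (Function.update p f 1) (connEvent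 ends y o ∩ (connEvent ends s y)ᶜ) * prob (Function.update p f 0) (clusterInEvent ends s 𝓤) - prob (Function.update p f 0) (clusterInEvent ends s 𝓤 ∩ connEvent ends y o ∩ (connEvent ends s y)ᶜ) * prob (Function.update p f 1) ((connEvent ends s y)ᶜ) - prob (Function.update p f 1) (clusterInEvent ends s 𝓤 ∩ connEvent ends y o ∩ (connEvent ends s y)ᶜ) * prob (Function.update p f 0) ((connEvent ends s y)ᶜ) - prob (Function.update p f 1) (clusterInEvent ends s 𝓤 ∩ connEvent ends y o ∩ (connEvent ends s y)ᶜ) * prob (Function.update p f 1) ((connEvent ends s y)ᶜ) + prob (Function.update p f 0) (connEvent ends y o ∩ (connEvent ends s y)ᶜ) * prob (Function.update p f 1) ((connEvent ends s y)ᶜ) * prob (Function.update p f 1) (clusterInEvent ends s 𝓤) + prob (Function.update p f 1) (connEvent ends y o ∩ (connEvent ends s y)ᶜ) * prob (Function.update p f 0) ((connEvent ends s y)ᶜ) * prob (Function.update p f 1) (clusterInEvent ends s 𝓤) + prob (Function.update p f 1) (connEvent ends y o ∩ (connEvent ends s y)ᶜ) * prob (Function.update p f 1) ((connEvent ends s y)ᶜ)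 * prob (Function.update p f 0) (clusterInEvent ends s 𝓤) + prob (Function.update p f 0) (connEvent ends s u ∩ connEvent ends y o ∩ (connEvent ends s y)ᶜ) * prob (Function.update p f 1) ((connEvent ends s y)ᶜ) * prob (Function.update p f 1) (clusterInEvent ends s 𝓤) + prob (Function.update p f 1) (connEvent ends s u ∩ connEvent ends y o ∩ (connEvent ends s y)ᶜ) * prob (Function.update p f 0) ((connEvent ends s y)ᶜ) * prob (Function.update p f 1) (clusterInEvent ends s 𝓤) + prob (Function.update p f 1) (connEvent ends s u ∩ connEvent ends y o ∩ (connEvent ends s y)ᶜ) * prob (Function.update p f 1) ((connEvent ends s y)ᶜ) * prob (Function.update p f 0) (clusterInEvent ends s 𝓤))) :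
    ∀ p : E → R, IsProbVec p →
      prob p (connEvent ends s y)ᶜ * prob p (clusterInEvent ends s 𝓤 ∩ connEvent ends y o ∩ (connEvent ends s y)ᶜ) ≤
        prob p (clusterInEvent ends s 𝓤) * (prob p (connEvent ends y o ∩ (connEvent ends s y)ᶜ) *
          (prob p (connEvent ends s y)ᶜ - prob p (connEvent ends s u ∩ (connEvent ends s y)ᶜ)) +
          prob p (connEvent ends s y)ᶜ * prob p (connEvent ends s u ∩ connEvent ends y o ∩ (connEvent ends s y)ᶜ)) := by
  intro p hp
  rw [← sub_nonneg]
  refine psi0_slack_nonneg_of_step ends s y o u 𝓤 (fun p hp hex => ?_) p hp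
  by_cases hT : ∃ e, (∃ v ∈ ends e, Conn ends (fun e => decide (p e = 1)) o v) ∧ p e ≠ 0 ∧ p e ≠ 1
  · obtain ⟨f, _, hf0, hf1, hC1, hC2⟩ := hbern p hp hT
    refine ⟨f, hf0, hf1, fun h0 h1 => ?_⟩
    rw [psi0_slack_eq_bernstein p ends s y o u 𝓤 f]
    exact psi0_step_algebra (hp.nonneg f) (hp.le_one f) h0 h1 hC1 hC2
  · obtain ⟨e, he0, he1⟩ := hex
    have hpin : ∀ e, (∃ v ∈ ends e, Conn ends (fun e => decide (p e = 1)) o v) →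
        p e = 0 ∨ p e = 1 := by
      intro e hv
      by_contra hne
      exact hT ⟨e, hv, fun h => hne (Or.inl h), fun h => hne (Or.inr h)⟩
    exact ⟨e, he0, he1, fun _ _ => by
      rw [psi0_slack_eq_zero_of_explored_o p hp ends s y o u 𝓤 hpin]⟩

end Psi0Pin

end Summit.Ventures.PercRepro2
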